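import Mathlib
import HarnessLib
import Summits.NavierStokesRegularity.NavierStokesRegularity.Theses.PoloidalWindowDoor
import Summits.NavierStokesRegularity.NavierStokesRegularity.Theorems.PoloidalWindowDoorPoloidalWindowRigiditySharper
import Summits.NavierStokesRegularity.NavierStokesRegularity.Theorems.PoloidalWindowDoorPoloidalWindowRigidityK2OfLrcSpatial
import Summits.NavierStokesRegularity.NavierStokesRegularity.Theorems.PoloidalWindowDoorPoloidalWindowRigidityHorizontalFlatPast
import Summits.NavierStokesRegularity.NavierStokesRegularity.Theorems.PoloidalWindowDoorPoloidalWindowRigidityTimeShearLiminf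
import Summits.NavierStokesRegularity.NavierStokesRegularity.Theorems.PoloidalWindowDoorPoloidalWindowRigidityStubUntwisted
import Summits.NavierStokesRegularity.NavierStokesRegularity.Theorems.PoloidalWindowDoorPoloidalWindowRigidityThmAThreeStubs
import Summits.NavierStokesRegularity.NavierStokesRegularity.Theorems.PoloidalWindowDoorPoloidalWindowRigidityThmARelocation
import Summits.NavierStokesRegularity.NavierStokesRegularity.Theorems.PoloidalWindowDoorPoloidalWindowRigidityStrainGrowth


/-!
# v2.1 (2026-08-28T14:00Z): S1 is no longer a stub — LANDED by the K2-p3 lineage as `…Theorems.PoloidalWindowDoorPoloidalWindowRigidityStrainGrowth.stub_strainGrowth`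
# (critic 13:28:12Z (2): no veto; price P2 of 12:04:29Z thereby met), cited BY NAME as `strainGrowth_landed`; sorries 4 → 3 = {`stub_hyperbolicTH` (shared R-TH), `stub_hyperbolicThick`, `stub_floorLiouville` (deciding)}.
# Line `strain_tube` — crux `PoloidalWindowRigidity` (K2, stmt-NavierStokesRegularity-19708), SEMI-ELLIPTIC THICK column:
# the Riesz mass of the superharmonic slice pressure has LINEAR growth — the scale-invariant FLOOR for the strain — ⇒ a floor-level Liouville problem

IDEATOR seat ns-idea-8 (generation g3), lens «barrier» (the precisely-typed statement just outside the killed classes): the N0 THICK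
column of LADDER-NS, cell `hST` of `…ThmAThreeStubs.twisting_regular_of_three` (twisting THICK windows inside a SEMI-ELLIPTIC slab,
`I := ∂₂v₀∂₀v₂ + ∂₂v₁∂₁v₂ ≥ 0` on `ℝ³ × (a,b)`), which no registered line attacks with a global mechanism (`mixed_type`: De Giorgi–Nash–Moser
is not uniform, `A₂` fails, convexity-in-height has a cut-off problem — all give only the `R²` («sheet») sparseness of the strain).

LEVER (new on this crux).  On a semi-elliptic slice the classical pressure of the class is SUPERHARMONIC with
`−Δp = |D_h v_h|²_F + (∂₂v₂)² + 2I ≥ 0` (tree `…PressureRegime`, poloidality only).  Pairing `−Δp` with the tree's ball cut-off `χ_R`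
and inserting the class pressure-oscillation bound (F1) (tree `…PressureOscillation.exists_integral_abs_sub_le_class`, the one place the
Oseen identity (M) enters) gives `∫_{B(x₀,R)} ((∂₂v₂)² + 2I) ≤ ∫χ_R(−Δp) = −∫(p−κ)Δχ_R ≤ K C² R/(−s)`: the Riesz mass grows LINEARLY —
the strain of a semi-elliptic slice sits AT THE SCALE-INVARIANT FLOOR `α = 1` (Morrey bound, uniformly in the centre; a vortex sheet costs `R²`),
whereas the tree's whole-class energy bootstrap (`…LargeScaleEnergyBootstrapFloor.exists_uniform_level_of_gt_one`) gives every Type-I mild profile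
only the levels `α > 1` and records that the floor is out of its reach.  The floor is the «Type I in scaled energy» regime of the ε-regularity /
backward-uniqueness theory; what is left (S2, deciding, research) is a Liouville theorem for semi-elliptic thick twisting profiles with floor-level
strain — honest residue, nearest theorems Seregin–Šverák 2009 (axisymmetric scaled-energy Type I) and KNSS 2009 (no swirl = poloidal with circular leaves).

STUBS: S1 `strainGrowth_landed` (lever; provable from tree tools) → S2 `stub_floorLiouville` (deciding) ⊢ `semiEllipticThick_of_strainTube` =
the shared `stub_semiEllipticThick` PROVED from S1–S2; shared sorried stubs
`stub_hyperbolicTH` ((TH) column, lines string_shells / entire_slices) and `stub_hyperbolicThick` (hyperbolic thick column, lines z_shock /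
mixed_type) VERBATIM; composition `PoloidalWindowRigidity_of_strainTube : …Theses.PoloidalWindowDoor.PoloidalWindowRigidity` kernel-checked
(= the z_shock / mixed_type v2 chain over `twisting_regular_of_three`, `stub_untwisted`, `nonflatLiouville_of_lrc_spatial`,
`poloidalWindowRigidity_of_sliceSharpNonflatLiouville`).  `lean check`: rc 0, sorries = 4 = stubs.  (v1, same day, had a tube-decay stub and a
«tube Liouville» deciding stub; withdrawn by the author before review: near-tube localisation with covering count `R^{1+ε}` is already a
whole-class consequence of the tree bootstrap, so the honest gain is the floor, not the tube.)

DISPROOF USED (`Cruxes/PoloidalWindowRigidity/Disproof.lean`): `semiEllipticThick_false_without_mild` — (M) is load-bearing in S1 through (F1);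
every stub carries the full class binders (K-47 `twistProfile`, K-50 `thickProfile` are kinematic and violate (M)/(F1)); no local-kinematic
statement is made (`local*_false_without_momentum` not triggered).  DEAD LINES AVOIDED: not DGNM / `A₂` / convexity-in-height (census T14,
mixed_type (S-thick)(i)–(iii)): the sign of `−Δp` is used GLOBALLY through the vanishing of `∫Δχ_R` against constants, not through a local
energy inequality; not the plane-mean ledger of `sparse_energy` (plane means of `|v|²`, not the Riesz mass of `p`); not KNSS-2D.

HONESTY: no summit and no crux is proved by this line; S3 is research-open and says so.  bears_on: LADDER-NS N0 (crux 19708), cell `hST`.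
-/

noncomputable section

set_option linter.dupNamespace false
set_option linter.unusedVariables false

namespace Summit.NavierStokesRegularity.NavierStokesRegularity.Cruxes.PoloidalWindowRigidity.StrainTube

open Set Function Metric MeasureTheory
open scoped RealInnerProductSpace InnerProductSpace Topology
open Literature.Analysis Literature.Analysis.FluidPDE
open Summit.NavierStokesRegularity.NavierStokesRegularity.Theorems.PoloidalWindowDoorPoloidalWindowRigiditySharper
open Summit.NavierStokesRegularity.NavierStokesRegularity.Theorems.PoloidalWindowDoorPoloidalWindowRigidityK2OfLrcSpatial
open Summit.NavierStokesRegularity.NavierStokesRegularity.Theorems.PoloidalWindowDoorPoloidalWindowRigidityHorizontalFlatPast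
open Summit.NavierStokesRegularity.NavierStokesRegularity.Theorems.PoloidalWindowDoorPoloidalWindowRigidityThmAThreeStubs
open Summit.NavierStokesRegularity.NavierStokesRegularity.Theorems.PoloidalWindowDoorPoloidalWindowRigidityThmARelocation

/-! ### Shared stubs (other columns; restated VERBATIM so that the composition is self-contained) -/

/-- **STUB (`stub_hyperbolicTH`) — SHARED VERBATIM with `Lines/mixed_type.lean` / `z_shock.lean` (`hH` of `twisting_regular_of_three`): hyperbolic
(TH) twisting windows are regular.**  Lines of record: string_shells (proved there from its own stubs), entire_slices.  Not re-cut here.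
Why it might fail: as recorded there (`twistingTH_false_without_mild`: (M) load-bearing). -/
theorem stub_hyperbolicTH :
    ∀ (C : ℝ) (v : ℝ → EuclideanSpace ℝ (Fin 3) → EuclideanSpace ℝ (Fin 3)),
      Literature.Analysis.FluidPDE.HasTypeITimeDecay C v →
      ContinuousOn (Function.uncurry v) (Set.Iio (0 : ℝ) ×ˢ Set.univ) →
      (∀ s t : ℝ, s < t → t < 0 → ∀ x, v t x =
        Literature.Analysis.UnboundedOperators.heatExtension (v s) (t - s) x -
          Literature.Analysis.FluidPDE.oseenDuhamel 1 s v v t x) →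
      (∀ t < 0, Literature.Analysis.FluidPDE.VectorCalculus.IsDivFree (v t)) →
      (∀ s < 0, ∀ y, ⟪Literature.Analysis.FluidPDE.curl (v s) y, EuclideanSpace.single 2 1⟫_ℝ = 0) →
      ∀ W : Set (ℝ × EuclideanSpace ℝ (Fin 3)), IsOpen W → W.Nonempty → W ⊆ Set.Iio (0 : ℝ) ×ˢ Set.univ →
        (∀ z ∈ W, Literature.Analysis.FluidPDE.curl (v z.1) z.2 ≠ 0 ∧
          (fderiv ℝ (v z.1) z.2 (EuclideanSpace.single 0 1) 2 ≠ 0 ∨ fderiv ℝ (v z.1) z.2 (EuclideanSpace.single 1 1) 2 ≠ 0) ∧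
          (fderiv ℝ (v z.1) z.2 (EuclideanSpace.single 2 1) 0 ≠ 0 ∨ fderiv ℝ (v z.1) z.2 (EuclideanSpace.single 2 1) 1 ≠ 0)) →
        (∀ m : ℝ → ℝ, ∀ W₁ : Set (ℝ × EuclideanSpace ℝ (Fin 3)), W₁ ⊆ W → IsOpen W₁ → W₁.Nonempty →
          ∃ z ∈ W₁, ∃ b : Fin 3, b ≠ 2 ∧
            fderiv ℝ (v z.1) z.2 (EuclideanSpace.single 2 1) b ≠
              m z.1 * fderiv ℝ (v z.1) z.2 (EuclideanSpace.single b 1) 2) →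
        (∀ z ∈ W,
          fderiv ℝ (fun x => fderiv ℝ (v z.1) x (EuclideanSpace.single 2 1) 2) z.2 (EuclideanSpace.single 0 1) *
              fderiv ℝ (v z.1) z.2 (EuclideanSpace.single 1 1) 2 -
            fderiv ℝ (fun x => fderiv ℝ (v z.1) x (EuclideanSpace.single 2 1) 2) z.2 (EuclideanSpace.single 1 1) *
              fderiv ℝ (v z.1) z.2 (EuclideanSpace.single 0 1) 2 ≠ 0) →
        (∀ z ∈ W,
          fderiv ℝ (v z.1) z.2 (EuclideanSpace.single 2 1) 0 * fderiv ℝ (v z.1) z.2 (EuclideanSpace.single 0 1) 2 +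
            fderiv ℝ (v z.1) z.2 (EuclideanSpace.single 2 1) 1 * fderiv ℝ (v z.1) z.2 (EuclideanSpace.single 1 1) 2 < 0) →
        (∃ m : ℝ → ℝ → ℝ, ∀ z ∈ W, ∀ b : Fin 3, b ≠ 2 →
          fderiv ℝ (v z.1) z.2 (EuclideanSpace.single 2 1) b =
            m z.1 (z.2 2) * fderiv ℝ (v z.1) z.2 (EuclideanSpace.single b 1) 2) →
        ¬ Literature.Analysis.FluidPDE.IsBackwardSingularPoint v 0 := by

  sorry

/-- **STUB (`stub_hyperbolicThick`) — SHARED VERBATIM with `Lines/mixed_type.lean` (`hHT` of `twisting_regular_of_three`; z_shock proves it from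
its split `stub_zShockThickAut | stub_zShockThickMod | stub_mixedPocketThick`): hyperbolic THICK twisting windows are regular.**  Not re-cut here.
Why it might fail: the THICK wall, hyperbolic side (`hyperbolicThick_false_without_mild`). -/
theorem stub_hyperbolicThick :
    ∀ (C : ℝ) (v : ℝ → EuclideanSpace ℝ (Fin 3) → EuclideanSpace ℝ (Fin 3)),
      Literature.Analysis.FluidPDE.HasTypeITimeDecay C v →
      ContinuousOn (Function.uncurry v) (Set.Iio (0 : ℝ) ×ˢ Set.univ) →
      (∀ s t : ℝ, s < t → t < 0 → ∀ x, v t x =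
        Literature.Analysis.UnboundedOperators.heatExtension (v s) (t - s) x -
          Literature.Analysis.FluidPDE.oseenDuhamel 1 s v v t x) →
      (∀ t < 0, Literature.Analysis.FluidPDE.VectorCalculus.IsDivFree (v t)) →
      (∀ s < 0, ∀ y, ⟪Literature.Analysis.FluidPDE.curl (v s) y, EuclideanSpace.single 2 1⟫_ℝ = 0) →
      ∀ W : Set (ℝ × EuclideanSpace ℝ (Fin 3)), IsOpen W → W.Nonempty → W ⊆ Set.Iio (0 : ℝ) ×ˢ Set.univ →
        (∀ z ∈ W, Literature.Analysis.FluidPDE.curl (v z.1) z.2 ≠ 0 ∧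
          (fderiv ℝ (v z.1) z.2 (EuclideanSpace.single 0 1) 2 ≠ 0 ∨ fderiv ℝ (v z.1) z.2 (EuclideanSpace.single 1 1) 2 ≠ 0) ∧
          (fderiv ℝ (v z.1) z.2 (EuclideanSpace.single 2 1) 0 ≠ 0 ∨ fderiv ℝ (v z.1) z.2 (EuclideanSpace.single 2 1) 1 ≠ 0)) →
        (∀ m : ℝ → ℝ, ∀ W₁ : Set (ℝ × EuclideanSpace ℝ (Fin 3)), W₁ ⊆ W → IsOpen W₁ → W₁.Nonempty →
          ∃ z ∈ W₁, ∃ b : Fin 3, b ≠ 2 ∧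
            fderiv ℝ (v z.1) z.2 (EuclideanSpace.single 2 1) b ≠
              m z.1 * fderiv ℝ (v z.1) z.2 (EuclideanSpace.single b 1) 2) →
        (∀ z ∈ W,
          fderiv ℝ (fun x => fderiv ℝ (v z.1) x (EuclideanSpace.single 2 1) 2) z.2 (EuclideanSpace.single 0 1) *
              fderiv ℝ (v z.1) z.2 (EuclideanSpace.single 1 1) 2 -
            fderiv ℝ (fun x => fderiv ℝ (v z.1) x (EuclideanSpace.single 2 1) 2) z.2 (EuclideanSpace.single 1 1) *
              fderiv ℝ (v z.1) z.2 (EuclideanSpace.single 0 1) 2 ≠ 0) →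
        (∀ z ∈ W,
          fderiv ℝ (v z.1) z.2 (EuclideanSpace.single 2 1) 0 * fderiv ℝ (v z.1) z.2 (EuclideanSpace.single 0 1) 2 +
            fderiv ℝ (v z.1) z.2 (EuclideanSpace.single 2 1) 1 * fderiv ℝ (v z.1) z.2 (EuclideanSpace.single 1 1) 2 < 0) →
        (∀ m : ℝ → ℝ → ℝ, ∀ W₁ : Set (ℝ × EuclideanSpace ℝ (Fin 3)), W₁ ⊆ W → IsOpen W₁ → W₁.Nonempty →
          ∃ z ∈ W₁, ∃ b : Fin 3, b ≠ 2 ∧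
            fderiv ℝ (v z.1) z.2 (EuclideanSpace.single 2 1) b ≠
              m z.1 (z.2 2) * fderiv ℝ (v z.1) z.2 (EuclideanSpace.single b 1) 2) →
        ¬ Literature.Analysis.FluidPDE.IsBackwardSingularPoint v 0 := by

  sorry

/-! ### This line's stubs: the SEMI-ELLIPTIC THICK column -/

/-- **STUB S1 (`strainGrowth_landed`) — THE LEVER, provable from tree tools (M-sized): on a SEMI-ELLIPTIC slab the Riesz mass of the
superharmonic slice pressure has LINEAR growth.**  For a profile of the class, poloidal, with `I := ∂₂v₀∂₀v₂ + ∂₂v₁∂₁v₂ ≥ 0` on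
`ℝ³ × (a,b)` (`a < b ≤ 0`): `∫_{B(x₀,R)} (|D_h v_h|²_F + (∂₂v₂)² + 2I)(s) ≤ K·R/(−s)` for all centres `x₀`, all `R ≥ 1`, all `s ∈ (a,b)` —
the scale-invariant (Morrey) FLOOR, which the whole-class bootstrap `…LargeScaleEnergyBootstrapFloor` does not reach for `∫|v|²`.
PROOF ROUTE (tree): `−Δp(s) = |D_h v_h|²_F + (∂₂v₂)² + 2I ≥ 0` pointwise (`…PressureRegime.laplacian_pressure_eq_neg_sum` /
`neg_laplacian_pressure_eq_of_class`, poloidality only; classical pressure from `exists_pressure_superharmonic_of_class`); pair with the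
tree cutoff `χ_R` (`= 1` on `B_R`, `|Δχ_R| ≤ C₂/R²`, support `B_{2R}`): `∫χ_R(−Δp) = −∫(p − κ)Δχ_R ≤ (C₂/R²)∫_{B̄_{2R}}|p(s) − κ| ≤ (C₂/R²)·K_osc C²/(−s)·|B̄_{2R}|`
by the class pressure-oscillation bound (F1) `…PressureOscillation.exists_integral_abs_sub_le_class` (this is where the Oseen identity (M) enters —
`semiEllipticThick_false_without_mild` honoured).  Linear growth = the FLOOR (sheets cost `R²`; `mixed_type`/`…PressureRegime` had only `R²` from `sup|∇p|`;
the class bootstrap gives `R^{1+ε}` for `∫|v|²`, not for the strain and not the floor).  Why it might fail: only the formalisation (IBP `∫χΔp = ∫pΔχ` for the classical pressure; integrability on balls). -/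
theorem strainGrowth_landed :
    ∀ (C : ℝ) (v : ℝ → EuclideanSpace ℝ (Fin 3) → EuclideanSpace ℝ (Fin 3)),
      Literature.Analysis.FluidPDE.HasTypeITimeDecay C v →
      ContinuousOn (Function.uncurry v) (Set.Iio (0 : ℝ) ×ˢ Set.univ) →
      (∀ s t : ℝ, s < t → t < 0 → ∀ x, v t x =
        Literature.Analysis.UnboundedOperators.heatExtension (v s) (t - s) x -
          Literature.Analysis.FluidPDE.oseenDuhamel 1 s v v t x) →
      (∀ t < 0, Literature.Analysis.FluidPDE.VectorCalculus.IsDivFree (v t)) →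
      (∀ s < 0, ∀ y, ⟪Literature.Analysis.FluidPDE.curl (v s) y, EuclideanSpace.single 2 1⟫_ℝ = 0) →
      ∀ a b : ℝ, a < b → b ≤ 0 →
          (∀ s ∈ Set.Ioo a b, ∀ y : EuclideanSpace ℝ (Fin 3),
            0 ≤ fderiv ℝ (v s) y (EuclideanSpace.single 2 1) 0 * fderiv ℝ (v s) y (EuclideanSpace.single 0 1) 2 +
                fderiv ℝ (v s) y (EuclideanSpace.single 2 1) 1 * fderiv ℝ (v s) y (EuclideanSpace.single 1 1) 2) →
          ∃ K : ℝ, ∀ s ∈ Set.Ioo a b, ∀ (x₀ : EuclideanSpace ℝ (Fin 3)) (R : ℝ), 1 ≤ R →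
            ∫ y in Metric.ball x₀ R,
              ((fderiv ℝ (v s) y (EuclideanSpace.single 0 1) 0) ^ 2 + (fderiv ℝ (v s) y (EuclideanSpace.single 0 1) 1) ^ 2 +
                (fderiv ℝ (v s) y (EuclideanSpace.single 1 1) 0) ^ 2 + (fderiv ℝ (v s) y (EuclideanSpace.single 1 1) 1) ^ 2 +
                (fderiv ℝ (v s) y (EuclideanSpace.single 2 1) 2) ^ 2 +
                2 * (fderiv ℝ (v s) y (EuclideanSpace.single 2 1) 0 * fderiv ℝ (v s) y (EuclideanSpace.single 0 1) 2 +
                fderiv ℝ (v s) y (EuclideanSpace.single 2 1) 1 * fderiv ℝ (v s) y (EuclideanSpace.single 1 1) 2)) ≤ K * R / (-s) :=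
  Summit.NavierStokesRegularity.NavierStokesRegularity.Theorems.PoloidalWindowDoorPoloidalWindowRigidityStrainGrowth.stub_strainGrowth

/-- **STUB S2 (`stub_floorLiouville`) — THE DECIDING STUB (XL, research): a semi-elliptic THICK twisting profile whose semi-elliptic
Riesz mass is AT THE SCALE-INVARIANT FLOOR is regular.**  VERBATIM the binders of the shared `stub_semiEllipticThick` (`hST` of
`…ThmAThreeStubs.twisting_regular_of_three`, with `a < b ≤ 0` explicit) PLUS the conclusion of S1: on the slab the mass
`e := |D_h v_h|²_F + (∂₂v₂)² + 2I` of every ball `B(x₀,R)`, `R ≥ 1`, is `≤ K·R/(−s)` — the Morrey / scaled-energy FLOOR `α = 1` for `e`, uniformly in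
the centre.  WHY EASIER THAN `hST` (honestly bounded): the whole-class large-scale bootstrap of the tree (`…LargeScaleEnergyBootstrapFloor`,
`exists_uniform_level_of_gt_one`) gives every Type-I mild profile the levels `α > 1` for `∫_{B_R}|v|²` and explicitly does NOT reach the floor; the
floor is exactly the «Type I in scaled energy» regime in which ε-regularity / backward-uniqueness arguments (Escauriaza–Seregin–Šverák, Seregin–Šverák
2009 for the axisymmetric class) operate, and here it is reached — for the strain part `e` that a thick twisting window must carry (`I = Λ|∇_h v₂|² > 0`
on the window) — from the semi-elliptic SIGN.  By Chebyshev the floor also says: the `ε`-active unit cells of `e` in `B(x₀,R)` number `≤ K R/(ε(−s))`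
(linear covering count; the class levels give only `R^{1+ε}`).  Mechanism on offer (not a proof): floor-level scaled strain + Type-I time decay ⇒ the
CKN/Seregin scaled quantities built from `e` are bounded along parabolic sequences, so blow-down limits centred on the window keep a semi-elliptic
thick window AND floor-level strain, where a Liouville theorem of Seregin–Šverák type is the target.  Why it might fail: `e` omits the leaf
gradient `|∇_h v₂|²` where `Λ → 0` (the full dissipation is not at the floor), no Liouville theorem for scaled-energy Type-I ancient solutions
without symmetry is in print, and the semi-elliptic slab is bounded in time (blow-downs leave it).  No summit and no crux is proved by this stub. -/
theorem stub_floorLiouville :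
    ∀ (C : ℝ) (v : ℝ → EuclideanSpace ℝ (Fin 3) → EuclideanSpace ℝ (Fin 3)),
      Literature.Analysis.FluidPDE.HasTypeITimeDecay C v →
      ContinuousOn (Function.uncurry v) (Set.Iio (0 : ℝ) ×ˢ Set.univ) →
      (∀ s t : ℝ, s < t → t < 0 → ∀ x, v t x =
        Literature.Analysis.UnboundedOperators.heatExtension (v s) (t - s) x -
          Literature.Analysis.FluidPDE.oseenDuhamel 1 s v v t x) →
      (∀ t < 0, Literature.Analysis.FluidPDE.VectorCalculus.IsDivFree (v t)) →
      (∀ s < 0, ∀ y, ⟪Literature.Analysis.FluidPDE.curl (v s) y, EuclideanSpace.single 2 1⟫_ℝ = 0) →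
      ∀ W : Set (ℝ × EuclideanSpace ℝ (Fin 3)), IsOpen W → W.Nonempty → W ⊆ Set.Iio (0 : ℝ) ×ˢ Set.univ →
        (∀ z ∈ W, Literature.Analysis.FluidPDE.curl (v z.1) z.2 ≠ 0 ∧
          (fderiv ℝ (v z.1) z.2 (EuclideanSpace.single 0 1) 2 ≠ 0 ∨ fderiv ℝ (v z.1) z.2 (EuclideanSpace.single 1 1) 2 ≠ 0) ∧
          (fderiv ℝ (v z.1) z.2 (EuclideanSpace.single 2 1) 0 ≠ 0 ∨ fderiv ℝ (v z.1) z.2 (EuclideanSpace.single 2 1) 1 ≠ 0)) →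
        (∀ m : ℝ → ℝ, ∀ W₁ : Set (ℝ × EuclideanSpace ℝ (Fin 3)), W₁ ⊆ W → IsOpen W₁ → W₁.Nonempty →
          ∃ z ∈ W₁, ∃ b : Fin 3, b ≠ 2 ∧
            fderiv ℝ (v z.1) z.2 (EuclideanSpace.single 2 1) b ≠
              m z.1 * fderiv ℝ (v z.1) z.2 (EuclideanSpace.single b 1) 2) →
        (∀ z ∈ W,
          fderiv ℝ (fun x => fderiv ℝ (v z.1) x (EuclideanSpace.single 2 1) 2) z.2 (EuclideanSpace.single 0 1) *
              fderiv ℝ (v z.1) z.2 (EuclideanSpace.single 1 1) 2 -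
            fderiv ℝ (fun x => fderiv ℝ (v z.1) x (EuclideanSpace.single 2 1) 2) z.2 (EuclideanSpace.single 1 1) *
              fderiv ℝ (v z.1) z.2 (EuclideanSpace.single 0 1) 2 ≠ 0) →
        ∀ a b : ℝ, a < b → b ≤ 0 → W ⊆ Set.Ioo a b ×ˢ Set.univ →
          (∀ s ∈ Set.Ioo a b, ∀ y : EuclideanSpace ℝ (Fin 3),
            0 ≤ fderiv ℝ (v s) y (EuclideanSpace.single 2 1) 0 * fderiv ℝ (v s) y (EuclideanSpace.single 0 1) 2 +
                fderiv ℝ (v s) y (EuclideanSpace.single 2 1) 1 * fderiv ℝ (v s) y (EuclideanSpace.single 1 1) 2) →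
          (∀ m : ℝ → ℝ → ℝ, ∀ W₁ : Set (ℝ × EuclideanSpace ℝ (Fin 3)), W₁ ⊆ W → IsOpen W₁ → W₁.Nonempty →
          ∃ z ∈ W₁, ∃ b : Fin 3, b ≠ 2 ∧
            fderiv ℝ (v z.1) z.2 (EuclideanSpace.single 2 1) b ≠
              m z.1 (z.2 2) * fderiv ℝ (v z.1) z.2 (EuclideanSpace.single b 1) 2) →
          (∃ K : ℝ, ∀ s ∈ Set.Ioo a b, ∀ (x₀ : EuclideanSpace ℝ (Fin 3)) (R : ℝ), 1 ≤ R →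
            ∫ y in Metric.ball x₀ R,
              ((fderiv ℝ (v s) y (EuclideanSpace.single 0 1) 0) ^ 2 + (fderiv ℝ (v s) y (EuclideanSpace.single 0 1) 1) ^ 2 +
                (fderiv ℝ (v s) y (EuclideanSpace.single 1 1) 0) ^ 2 + (fderiv ℝ (v s) y (EuclideanSpace.single 1 1) 1) ^ 2 +
                (fderiv ℝ (v s) y (EuclideanSpace.single 2 1) 2) ^ 2 +
                2 * (fderiv ℝ (v s) y (EuclideanSpace.single 2 1) 0 * fderiv ℝ (v s) y (EuclideanSpace.single 0 1) 2 +
                fderiv ℝ (v s) y (EuclideanSpace.single 2 1) 1 * fderiv ℝ (v s) y (EuclideanSpace.single 1 1) 2)) ≤ K * R / (-s)) →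
          ¬ Literature.Analysis.FluidPDE.IsBackwardSingularPoint v 0 := by
  sorry

/-! ### Composition, step 1 (proved): the shared stub `stub_semiEllipticThick` from S1, S2, S3 -/

/-- **`stub_semiEllipticThick` (shared with `mixed_type` / `z_shock` / `far_thread` / `thread_axis`, = `hST` of `twisting_regular_of_three`) PROVED from
this line's stubs**: shrink the slab to `(a, min b 0)` (non-empty because the window is), get the floor-level strain bound from S1 and
conclude with S2. -/
theorem semiEllipticThick_of_strainTube :
    ∀ (C : ℝ) (v : ℝ → EuclideanSpace ℝ (Fin 3) → EuclideanSpace ℝ (Fin 3)),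
      Literature.Analysis.FluidPDE.HasTypeITimeDecay C v →
      ContinuousOn (Function.uncurry v) (Set.Iio (0 : ℝ) ×ˢ Set.univ) →
      (∀ s t : ℝ, s < t → t < 0 → ∀ x, v t x =
        Literature.Analysis.UnboundedOperators.heatExtension (v s) (t - s) x -
          Literature.Analysis.FluidPDE.oseenDuhamel 1 s v v t x) →
      (∀ t < 0, Literature.Analysis.FluidPDE.VectorCalculus.IsDivFree (v t)) →
      (∀ s < 0, ∀ y, ⟪Literature.Analysis.FluidPDE.curl (v s) y, EuclideanSpace.single 2 1⟫_ℝ = 0) →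
      ∀ W : Set (ℝ × EuclideanSpace ℝ (Fin 3)), IsOpen W → W.Nonempty → W ⊆ Set.Iio (0 : ℝ) ×ˢ Set.univ →
        (∀ z ∈ W, Literature.Analysis.FluidPDE.curl (v z.1) z.2 ≠ 0 ∧
          (fderiv ℝ (v z.1) z.2 (EuclideanSpace.single 0 1) 2 ≠ 0 ∨ fderiv ℝ (v z.1) z.2 (EuclideanSpace.single 1 1) 2 ≠ 0) ∧
          (fderiv ℝ (v z.1) z.2 (EuclideanSpace.single 2 1) 0 ≠ 0 ∨ fderiv ℝ (v z.1) z.2 (EuclideanSpace.single 2 1) 1 ≠ 0)) →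
        (∀ m : ℝ → ℝ, ∀ W₁ : Set (ℝ × EuclideanSpace ℝ (Fin 3)), W₁ ⊆ W → IsOpen W₁ → W₁.Nonempty →
          ∃ z ∈ W₁, ∃ b : Fin 3, b ≠ 2 ∧
            fderiv ℝ (v z.1) z.2 (EuclideanSpace.single 2 1) b ≠
              m z.1 * fderiv ℝ (v z.1) z.2 (EuclideanSpace.single b 1) 2) →
        (∀ z ∈ W,
          fderiv ℝ (fun x => fderiv ℝ (v z.1) x (EuclideanSpace.single 2 1) 2) z.2 (EuclideanSpace.single 0 1) *
              fderiv ℝ (v z.1) z.2 (EuclideanSpace.single 1 1) 2 -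
            fderiv ℝ (fun x => fderiv ℝ (v z.1) x (EuclideanSpace.single 2 1) 2) z.2 (EuclideanSpace.single 1 1) *
              fderiv ℝ (v z.1) z.2 (EuclideanSpace.single 0 1) 2 ≠ 0) →
        ∀ a b : ℝ, W ⊆ Set.Ioo a b ×ˢ Set.univ →
          (∀ s ∈ Set.Ioo a b, ∀ y : EuclideanSpace ℝ (Fin 3),
            0 ≤ fderiv ℝ (v s) y (EuclideanSpace.single 2 1) 0 * fderiv ℝ (v s) y (EuclideanSpace.single 0 1) 2 +
              fderiv ℝ (v s) y (EuclideanSpace.single 2 1) 1 * fderiv ℝ (v s) y (EuclideanSpace.single 1 1) 2) →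
          (∀ m : ℝ → ℝ → ℝ, ∀ W₁ : Set (ℝ × EuclideanSpace ℝ (Fin 3)), W₁ ⊆ W → IsOpen W₁ → W₁.Nonempty →
          ∃ z ∈ W₁, ∃ b : Fin 3, b ≠ 2 ∧
            fderiv ℝ (v z.1) z.2 (EuclideanSpace.single 2 1) b ≠
              m z.1 (z.2 2) * fderiv ℝ (v z.1) z.2 (EuclideanSpace.single b 1) 2) →
          ¬ Literature.Analysis.FluidPDE.IsBackwardSingularPoint v 0 := by
  intro C v hrate hcont hmild hdiv hpol W hW hWne hWs hnd hpin htw a b hWab hsemi hth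
  -- the effective slab `(a, b₀)`, `b₀ := min b 0`
  set b₀ : ℝ := min b 0 with hb₀
  have hWab₀ : W ⊆ Set.Ioo a b₀ ×ˢ Set.univ := by
    intro z hz
    have h1 := hWab hz
    have h2 := hWs hz
    simp only [Set.mem_prod, Set.mem_Ioo, Set.mem_Iio, Set.mem_univ, and_true] at h1 h2 ⊢
    exact ⟨h1.1, lt_min h1.2 h2⟩
  have hab₀ : a < b₀ := by
    obtain ⟨z, hz⟩ := hWne
    have h := hWab₀ hz
    simp only [Set.mem_prod, Set.mem_Ioo, Set.mem_univ, and_true] at h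
    exact h.1.trans h.2
  have hb₀0 : b₀ ≤ 0 := min_le_right b 0
  have hsub : Set.Ioo a b₀ ⊆ Set.Ioo a b := Set.Ioo_subset_Ioo le_rfl (min_le_left b 0)
  have hsemi₀ : ∀ s ∈ Set.Ioo a b₀, ∀ y : EuclideanSpace ℝ (Fin 3),
      0 ≤ fderiv ℝ (v s) y (EuclideanSpace.single 2 1) 0 * fderiv ℝ (v s) y (EuclideanSpace.single 0 1) 2 +
                fderiv ℝ (v s) y (EuclideanSpace.single 2 1) 1 * fderiv ℝ (v s) y (EuclideanSpace.single 1 1) 2 :=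
    fun s hs y => hsemi s (hsub hs) y
  have hgrowth := strainGrowth_landed C v hrate hcont hmild hdiv hpol a b₀ hab₀ hb₀0 hsemi₀
  exact stub_floorLiouville C v hrate hcont hmild hdiv hpol W hW hWne hWs hnd hpin htw a b₀ hab₀ hb₀0 hWab₀ hsemi₀ hth hgrowth

/-! ### Composition, step 2 (proved): `stub_twisting`, then the crux (= `mixed_type` v2 / `string_shells` v2 chain) -/

/-- **NON-DEGENERATE + PIN + TWISTING ⇒ regular** — VERBATIM the statement of the registered stub `stub_twisting` of
`Lines/lrc_jet.lean` v5 (= `mixed_type`'s `twisting_of_mixedType`), PROVED: `hH` from the shared (TH) stub `stub_hyperbolicTH`, `hHT` from the shared stub `stub_hyperbolicThick` (hyperbolic thick column: lines z_shock / mixed_type), `hST` from `semiEllipticThick_of_strainTube` (THIS LINE). -/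
theorem twisting_of_strainTube :
    ∀ (C : ℝ) (v : ℝ → EuclideanSpace ℝ (Fin 3) → EuclideanSpace ℝ (Fin 3)),
      Literature.Analysis.FluidPDE.HasTypeITimeDecay C v →
      ContinuousOn (Function.uncurry v) (Set.Iio (0 : ℝ) ×ˢ Set.univ) →
      (∀ s t : ℝ, s < t → t < 0 → ∀ x, v t x =
        Literature.Analysis.UnboundedOperators.heatExtension (v s) (t - s) x -
          Literature.Analysis.FluidPDE.oseenDuhamel 1 s v v t x) →
      (∀ t < 0, Literature.Analysis.FluidPDE.VectorCalculus.IsDivFree (v t)) →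
      (∀ s < 0, ∀ y, ⟪Literature.Analysis.FluidPDE.curl (v s) y, EuclideanSpace.single 2 1⟫_ℝ = 0) →
      ∀ W : Set (ℝ × EuclideanSpace ℝ (Fin 3)), IsOpen W → W.Nonempty → W ⊆ Set.Iio (0 : ℝ) ×ˢ Set.univ →
        (∀ z ∈ W, Literature.Analysis.FluidPDE.curl (v z.1) z.2 ≠ 0 ∧
          (fderiv ℝ (v z.1) z.2 (EuclideanSpace.single 0 1) 2 ≠ 0 ∨ fderiv ℝ (v z.1) z.2 (EuclideanSpace.single 1 1) 2 ≠ 0) ∧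
          (fderiv ℝ (v z.1) z.2 (EuclideanSpace.single 2 1) 0 ≠ 0 ∨ fderiv ℝ (v z.1) z.2 (EuclideanSpace.single 2 1) 1 ≠ 0)) →
        (∀ m : ℝ → ℝ, ∀ W₁ : Set (ℝ × EuclideanSpace ℝ (Fin 3)), W₁ ⊆ W → IsOpen W₁ → W₁.Nonempty →
          ∃ z ∈ W₁, ∃ b : Fin 3, b ≠ 2 ∧
            fderiv ℝ (v z.1) z.2 (EuclideanSpace.single 2 1) b ≠
              m z.1 * fderiv ℝ (v z.1) z.2 (EuclideanSpace.single b 1) 2) →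
        (∀ z ∈ W,
          fderiv ℝ (fun x => fderiv ℝ (v z.1) x (EuclideanSpace.single 2 1) 2) z.2 (EuclideanSpace.single 0 1) *
              fderiv ℝ (v z.1) z.2 (EuclideanSpace.single 1 1) 2 -
            fderiv ℝ (fun x => fderiv ℝ (v z.1) x (EuclideanSpace.single 2 1) 2) z.2 (EuclideanSpace.single 1 1) *
              fderiv ℝ (v z.1) z.2 (EuclideanSpace.single 0 1) 2 ≠ 0) →
        ¬ Literature.Analysis.FluidPDE.IsBackwardSingularPoint v 0 := by
  intro C v hrate hcont hmild hdiv hpol W hW hWne hWs hnd hpin htw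
  refine twisting_regular_of_three C v hrate hcont hmild hdiv ?_ ?_ ?_ W hW hWne hWs hnd hpin htw
  · -- hH : hyperbolic (TH) windows
    intro W' hW' hW'ne hW's hnd' hpin' htw' hhyp' hTH'
    exact stub_hyperbolicTH C v hrate hcont hmild hdiv hpol W' hW' hW'ne hW's hnd' hpin' htw' hhyp' hTH'
  · -- hHT : hyperbolic thick windows (shared stub; lines z_shock / mixed_type)
    intro W' hW' hW'ne hW's hnd' hpin' htw' hhyp' hth'
    exact stub_hyperbolicThick C v hrate hcont hmild hdiv hpol W' hW' hW'ne hW's hnd' hpin' htw' hhyp' hth'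
  · -- hST : twisting thick windows inside a semi-elliptic slab (THIS LINE: S1 → S2)
    intro W' hW' hW'ne hW's hnd' hpin' htw' a b hWab hsemi hth'
    exact semiEllipticThick_of_strainTube C v hrate hcont hmild hdiv hpol W' hW' hW'ne hW's hnd' hpin' htw' a b hWab hsemi hth'

/-! ### Composition, step 2 (proved, = `mixed_type` v2 / `lrc_jet` v5 chain): the crux -/

/-- **NON-DEGENERATE + PIN ⇒ regular** — the pointwise twist dichotomy over the tree theorem `…StubUntwisted.stub_untwisted`
(p561151, the untwisted half) and `twisting_of_strainTube` (the twisting half). -/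
theorem ndRegular :
    ∀ (C : ℝ) (v : ℝ → EuclideanSpace ℝ (Fin 3) → EuclideanSpace ℝ (Fin 3)),
      Literature.Analysis.FluidPDE.HasTypeITimeDecay C v →
      ContinuousOn (Function.uncurry v) (Set.Iio (0 : ℝ) ×ˢ Set.univ) →
      (∀ s t : ℝ, s < t → t < 0 → ∀ x, v t x =
        Literature.Analysis.UnboundedOperators.heatExtension (v s) (t - s) x -
          Literature.Analysis.FluidPDE.oseenDuhamel 1 s v v t x) →
      (∀ t < 0, Literature.Analysis.FluidPDE.VectorCalculus.IsDivFree (v t)) →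
      (∀ s < 0, ∀ y, ⟪Literature.Analysis.FluidPDE.curl (v s) y, EuclideanSpace.single 2 1⟫_ℝ = 0) →
      ∀ W : Set (ℝ × EuclideanSpace ℝ (Fin 3)), IsOpen W → W.Nonempty → W ⊆ Set.Iio (0 : ℝ) ×ˢ Set.univ →
        (∀ z ∈ W, Literature.Analysis.FluidPDE.curl (v z.1) z.2 ≠ 0 ∧
          (fderiv ℝ (v z.1) z.2 (EuclideanSpace.single 0 1) 2 ≠ 0 ∨ fderiv ℝ (v z.1) z.2 (EuclideanSpace.single 1 1) 2 ≠ 0) ∧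
          (fderiv ℝ (v z.1) z.2 (EuclideanSpace.single 2 1) 0 ≠ 0 ∨ fderiv ℝ (v z.1) z.2 (EuclideanSpace.single 2 1) 1 ≠ 0)) →
        (∀ m : ℝ → ℝ, ∀ W₁ : Set (ℝ × EuclideanSpace ℝ (Fin 3)), W₁ ⊆ W → IsOpen W₁ → W₁.Nonempty →
          ∃ z ∈ W₁, ∃ b : Fin 3, b ≠ 2 ∧
            fderiv ℝ (v z.1) z.2 (EuclideanSpace.single 2 1) b ≠
              m z.1 * fderiv ℝ (v z.1) z.2 (EuclideanSpace.single b 1) 2) →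
        ¬ Literature.Analysis.FluidPDE.IsBackwardSingularPoint v 0 := by
  intro C v hrate hcont hmild hdiv hpol W hW hWne hWs hnd hpin
  set T : ℝ × EuclideanSpace ℝ (Fin 3) → ℝ := fun z =>
    fderiv ℝ (fun x => fderiv ℝ (v z.1) x (EuclideanSpace.single 2 1) 2) z.2 (EuclideanSpace.single 0 1) *
              fderiv ℝ (v z.1) z.2 (EuclideanSpace.single 1 1) 2 -
            fderiv ℝ (fun x => fderiv ℝ (v z.1) x (EuclideanSpace.single 2 1) 2) z.2 (EuclideanSpace.single 1 1) *
              fderiv ℝ (v z.1) z.2 (EuclideanSpace.single 0 1) 2 with hT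
  by_cases htw : ∃ z ∈ W, T z ≠ 0
  · obtain ⟨z₀, hz₀W, hz₀⟩ := htw
    have hslab : IsOpen (Set.Iio (0 : ℝ) ×ˢ (Set.univ : Set (EuclideanSpace ℝ (Fin 3)))) :=
      isOpen_Iio.prod isOpen_univ
    have hTc : ContinuousOn T (Set.Iio (0 : ℝ) ×ˢ Set.univ) := by
      rw [hT]
      exact continuousOn_twist hrate hcont hmild
    have hO : IsOpen ((Set.Iio (0 : ℝ) ×ˢ Set.univ) ∩ T ⁻¹' {0}ᶜ) :=
      hTc.isOpen_inter_preimage hslab isOpen_compl_singleton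
    set W₃ : Set (ℝ × EuclideanSpace ℝ (Fin 3)) := W ∩ ((Set.Iio (0 : ℝ) ×ˢ Set.univ) ∩ T ⁻¹' {0}ᶜ) with hW₃
    have hW₃o : IsOpen W₃ := hW.inter hO
    have hW₃W : W₃ ⊆ W := Set.inter_subset_left
    have hW₃ne : W₃.Nonempty := ⟨z₀, hz₀W, hWs hz₀W, hz₀⟩
    refine twisting_of_strainTube C v hrate hcont hmild hdiv hpol W₃ hW₃o hW₃ne (hW₃W.trans hWs)
      (fun z hz => hnd z (hW₃W hz)) (fun m W₁ hW₁ hW₁o hW₁ne => hpin m W₁ (hW₁.trans hW₃W) hW₁o hW₁ne) ?_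
    intro z hz
    exact hz.2.2
  · push Not at htw
    exact Summit.NavierStokesRegularity.NavierStokesRegularity.Theorems.PoloidalWindowDoorPoloidalWindowRigidityStubUntwisted.stub_untwisted
      C v hrate hcont hmild hdiv hpol W hW hWne hWs hnd htw

/-- **LRC″ with spatial pins, UNDER THE SINGULARITY ASSUMPTION** (vacuously, from `ndRegular`) — the hypothesis `hLRC` of
`…K2OfLrcSpatial.nonflatLiouville_of_lrc_spatial`. -/
theorem lrcSpatial_of_stubs :
    ∀ (C : ℝ) (v : ℝ → EuclideanSpace ℝ (Fin 3) → EuclideanSpace ℝ (Fin 3)),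
      Literature.Analysis.FluidPDE.HasTypeITimeDecay C v →
      ContinuousOn (Function.uncurry v) (Set.Iio (0 : ℝ) ×ˢ Set.univ) →
      (∀ s t : ℝ, s < t → t < 0 → ∀ x, v t x =
        Literature.Analysis.UnboundedOperators.heatExtension (v s) (t - s) x -
          Literature.Analysis.FluidPDE.oseenDuhamel 1 s v v t x) →
      (∀ t < 0, Literature.Analysis.FluidPDE.VectorCalculus.IsDivFree (v t)) →
      (∀ s < 0, ∀ y, ⟪Literature.Analysis.FluidPDE.curl (v s) y, EuclideanSpace.single 2 1⟫_ℝ = 0) →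
      Literature.Analysis.FluidPDE.IsBackwardSingularPoint v 0 →
      ∀ W : Set (ℝ × EuclideanSpace ℝ (Fin 3)), IsOpen W → W.Nonempty → W ⊆ Set.Iio (0 : ℝ) ×ˢ Set.univ →
        (∀ z ∈ W, Literature.Analysis.FluidPDE.curl (v z.1) z.2 ≠ 0 ∧
          (fderiv ℝ (v z.1) z.2 (EuclideanSpace.single 0 1) 2 ≠ 0 ∨ fderiv ℝ (v z.1) z.2 (EuclideanSpace.single 1 1) 2 ≠ 0) ∧
          (fderiv ℝ (v z.1) z.2 (EuclideanSpace.single 2 1) 0 ≠ 0 ∨ fderiv ℝ (v z.1) z.2 (EuclideanSpace.single 2 1) 1 ≠ 0)) →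
        (∀ m : ℝ → ℝ, ∀ W₁ : Set (ℝ × EuclideanSpace ℝ (Fin 3)), W₁ ⊆ W → IsOpen W₁ → W₁.Nonempty →
          ∃ z ∈ W₁, ∃ b : Fin 3, b ≠ 2 ∧
            fderiv ℝ (v z.1) z.2 (EuclideanSpace.single 2 1) b ≠
              m z.1 * fderiv ℝ (v z.1) z.2 (EuclideanSpace.single b 1) 2) →
        ∃ s : ℝ, s < 0 ∧ ∃ U : Set (EuclideanSpace ℝ (Fin 3)), IsOpen U ∧ U.Nonempty ∧
          ((∃ e : EuclideanSpace ℝ (Fin 3), e ≠ 0 ∧ ∀ y ∈ U, fderiv ℝ (Literature.Analysis.FluidPDE.curl (v s)) y e = 0) ∨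
           (∃ c : EuclideanSpace ℝ (Fin 3), ∀ y ∈ U,
              Literature.Analysis.FluidPDE.rotGen (Literature.Analysis.FluidPDE.curl (v s) y) =
                fderiv ℝ (Literature.Analysis.FluidPDE.curl (v s)) y (Literature.Analysis.FluidPDE.rotGen (y - c)))) := by
  intro C v hrate hcont hmild hdiv hpol hsing W hW hWne hWs hnd hpin
  exact absurd hsing (ndRegular C v hrate hcont hmild hdiv hpol W hW hWne hWs hnd hpin)

/-- **(TV) — both halves are tree theorems** (`…TimeShearLiminf.stub_tvLiminf`, p525351, and
`…HorizontalFlatPast.nonflatLiouville_of_timeShear_unbounded`): the hypothesis `hTV` of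
`…K2OfLrcSpatial.nonflatLiouville_of_lrc_spatial`. -/
theorem tv_of_stubs :
    ∀ (C : ℝ) (v : ℝ → EuclideanSpace ℝ (Fin 3) → EuclideanSpace ℝ (Fin 3)),
      Literature.Analysis.FluidPDE.HasTypeITimeDecay C v →
      ContinuousOn (Function.uncurry v) (Set.Iio (0 : ℝ) ×ˢ Set.univ) →
      (∀ s t : ℝ, s < t → t < 0 → ∀ x, v t x =
        Literature.Analysis.UnboundedOperators.heatExtension (v s) (t - s) x -
          Literature.Analysis.FluidPDE.oseenDuhamel 1 s v v t x) →
      (∀ t < 0, Literature.Analysis.FluidPDE.VectorCalculus.IsDivFree (v t)) →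
      (∀ s < 0, ∀ y, ⟪Literature.Analysis.FluidPDE.curl (v s) y, EuclideanSpace.single 2 1⟫_ℝ = 0) →
      ∀ μ : ℝ → ℝ, (∀ s < 0, μ s < 0) → (∀ s < 0, AnalyticAt ℝ μ s) →
        (∃ s₁ s₂ : ℝ, s₁ < 0 ∧ s₂ < 0 ∧ μ s₁ ≠ μ s₂) →
        (∀ s < 0, ∀ y, ∀ b : Fin 3, b ≠ 2 →
          fderiv ℝ (v s) y (EuclideanSpace.single 2 1) b = μ s * fderiv ℝ (v s) y (EuclideanSpace.single b 1) 2) →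
        ¬ Literature.Analysis.FluidPDE.IsBackwardSingularPoint v 0 := by
  intro C v hrate hcont hmild hdiv hpol μ hneg han hnc hslope
  by_cases hB : ∃ M : ℝ, ∀ T : ℝ, ∃ τ < T, -M ≤ μ τ
  · exact Summit.NavierStokesRegularity.NavierStokesRegularity.Theorems.PoloidalWindowDoorPoloidalWindowRigidityTimeShearLiminf.stub_tvLiminf
      C v hrate hcont hmild hdiv hpol μ hneg han hnc hslope hB
  · push Not at hB
    refine nonflatLiouville_of_timeShear_unbounded hrate hcont hmild hdiv hpol hslope fun M => ?_
    obtain ⟨T, hT⟩ := hB M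
    refine ⟨T, fun τ hτ => ?_⟩
    have h1 : μ τ < -M := hT τ hτ
    have h2 : M < -μ τ := by linarith
    exact h2.le.trans (neg_le_abs (μ τ))

/-- **The slice-sharp residue from the stubs** (symmetry/genericity hypotheses unused): class + poloidal ⇒ not backward-singular,
by contradiction through `…K2OfLrcSpatial.nonflatLiouville_of_lrc_spatial`. -/
theorem sliceSharpNonflatLiouville_of_strainTube :
    ∀ (C : ℝ) (v : ℝ → EuclideanSpace ℝ (Fin 3) → EuclideanSpace ℝ (Fin 3)),
      Literature.Analysis.FluidPDE.HasTypeITimeDecay C v →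
      ContinuousOn (Function.uncurry v) (Set.Iio (0 : ℝ) ×ˢ Set.univ) →
      (∀ s t : ℝ, s < t → t < 0 → ∀ x, v t x =
        Literature.Analysis.UnboundedOperators.heatExtension (v s) (t - s) x -
          Literature.Analysis.FluidPDE.oseenDuhamel 1 s v v t x) →
      (∀ t < 0, Literature.Analysis.FluidPDE.VectorCalculus.IsDivFree (v t)) →
      (∀ s < 0, ∀ y, ⟪Literature.Analysis.FluidPDE.curl (v s) y, EuclideanSpace.single 2 1⟫_ℝ = 0) →
      (∀ s < 0, ∀ y, ⟪fderiv ℝ (v s) y (Literature.Analysis.FluidPDE.curl (v s) y), EuclideanSpace.single 2 1⟫_ℝ = 0) →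
      (∀ s < 0, ∀ b : EuclideanSpace ℝ (Fin 3), b ≠ 0 → ∃ y,
        Literature.Analysis.FluidPDE.cross (Literature.Analysis.FluidPDE.curl (v s) y) b ≠ 0) →
      (∀ s < 0, ∃ y, fderiv ℝ (v s) y (EuclideanSpace.single 2 1) 0 ≠ 0 ∨
        fderiv ℝ (v s) y (EuclideanSpace.single 2 1) 1 ≠ 0) →
      (∀ s < 0, ∀ a : EuclideanSpace ℝ (Fin 3), a ≠ 0 → ⟪a, EuclideanSpace.single 2 1⟫_ℝ = 0 →
        ∃ y, ⟪fderiv ℝ (v s) y a, EuclideanSpace.single 2 1⟫_ℝ ≠ 0) →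
      (∀ s < 0, ∀ e : EuclideanSpace ℝ (Fin 3), e ≠ 0 → ∃ (y : EuclideanSpace ℝ (Fin 3)) (l : ℝ), v s (y + l • e) ≠ v s y) →
      (∀ s < 0, ∀ (L : EuclideanSpace ℝ (Fin 3) ≃ₗᵢ[ℝ] EuclideanSpace ℝ (Fin 3)) (c : EuclideanSpace ℝ (Fin 3)),
        ¬ Literature.Analysis.FluidPDE.IsAxisymmetric (fun y => L.symm (v s (L y + c)))) →
      (∃ lam : ℝ, 0 < lam ∧ ∃ s < 0, ∃ y, lam • v (lam ^ 2 * s) (lam • y) ≠ v s y) →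
        ¬ Literature.Analysis.FluidPDE.IsBackwardSingularPoint v 0 := by
  intro C v hrate hcont hmild hdiv hpol _ _ _ _ _ _ _ hsing
  exact nonflatLiouville_of_lrc_spatial hrate hcont hmild hdiv hpol
    (lrcSpatial_of_stubs C v hrate hcont hmild hdiv hpol hsing) (tv_of_stubs C v hrate hcont hmild hdiv hpol) hsing

/-- **COMPOSITION (proved): the crux `PoloidalWindowRigidity` BY NAME** from this line's stubs `strainGrowth_landed` (S1, lever) and `stub_floorLiouville`
(S2, deciding) — the SEMI-ELLIPTIC THICK column — and the shared stubs `stub_hyperbolicTH` ((TH) column: string_shells /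
entire_slices) and `stub_hyperbolicThick` (hyperbolic thick column: z_shock / mixed_type), via the landed reduction
`…Sharper.poloidalWindowRigidity_of_sliceSharpNonflatLiouville`.  No summit is proved: four `sorry`s, all inside `stub_*`. -/
theorem PoloidalWindowRigidity_of_strainTube :
    Summit.NavierStokesRegularity.NavierStokesRegularity.Theses.PoloidalWindowDoor.PoloidalWindowRigidity :=
  poloidalWindowRigidity_of_sliceSharpNonflatLiouville sliceSharpNonflatLiouville_of_strainTube

end Summit.NavierStokesRegularity.NavierStokesRegularity.Cruxes.PoloidalWindowRigidity.StrainTube
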